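import Summits.QuantumFields.YangMills.Theorems.F4SubCurvatureDoorRationalToGeneralDirectionalExtension
import Summits.QuantumFields.YangMills.Theorems.F4SubCurvatureDoorFibreDichotomyAxisRungs
import Mathlib
import HarnessLib

/-!
# S1 programme (⟨stmt-QuantumFields-23125⟩) — glue `linearAperture_of`:
# `DirectionalExtension → QuantitativeCrossAnalyticity → PringsheimIdentification → LinearAperture`

Crux `F4SubCurvatureDoor.RationalToGeneral` ⟨stmt-QuantumFields-23125⟩, owner file `Cruxes/RationalToGeneral/Lines/forward_cone_rungs.lean`
(ns `…Cruxes.RationalToGeneral.ForwardConeRungs`, v4; the native 4-D plan for the XL stub S1 `ForwardConeSupport`).  This file restates R-S1×⁺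
`QuantitativeCrossAnalyticity`, `PringsheimIdentification` and R-S1b `LinearAperture` CHARACTER-IDENTICALLY (R-S1∂ `DirectionalExtension` is
imported from the landed rung file `…DirectionalExtension`, p717588) and proves the owner's «M glue» (ym-idea-3 g21, 2026-08-29T12:10:34Z):

  `linearAperture_of : DirectionalExtension → QuantitativeCrossAnalyticity → PringsheimIdentification → LinearAperture`.

PROOF.  Frame `v = (e₀, ½(1,1,1,1), ½(1,1,−1,−1), ½(1,−1,1,−1))`, realised as `vⱼ = Rⱼ e₀` for the `D₄`-isometries `Rⱼ ∈ {refl, hadIso,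
hadIso ∘ signs, hadIso ∘ signs}` of the tree (`…FibreDichotomyAxisRungs`, p717372); `v` is linearly independent.  At `x₀ = t e₀` with `r = t/8`
every point `x` of the Euclidean `r`-ball has `⟪x, vⱼ⟫ ≥ t/4 > r`, so `DirectionalExtension` supplies, along every `vⱼ`, a holomorphic extension on
the disc of radius `r` with the UNIFORM bound `M = K(timeSpace (t/8) 0)` (the axis function `s ↦ K(s e₀) = ∫ e^{−sE} dμ` is antitone because
`E ≥ 0` a.e.); `K` is continuous on the ball (it avoids `0`).  `QuantitativeCrossAnalyticity` then gives ONE holomorphic `G` on the complex sup-ball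
of radius `c·r` about `x₀` with the same bound; its slice `z⃗ ↦ G(t, z⃗)` on the sup-ball of radius `ρ = c·r/2` in `ℂ³` equals
`y⃗ ↦ K(t, y⃗) = ∫ e^{−tE} cos(Σ qⱼyⱼ) dμ` on the real cube (which lies inside the Euclidean ball, `√3/2 < 1`), so `PringsheimIdentification`
bounds the three axis exponential moments `∫ e^{−tE + δ|qⱼ|} dμ ≤ 2M` for `δ < ρ`; with `δ = 3κt`, `κ = c/96`, the arithmetic–geometric mean
inequality `e^{κt‖q⃗‖} ≤ e^{κtΣ|qⱼ|} ≤ ⅓ Σⱼ e^{3κt|qⱼ|}` gives `∫ e^{−tE + κt‖q⃗‖} dμ ≤ 2M = 2·K(timeSpace (t/8) 0)`: `LinearAperture` with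
`(κ, c, C₀) = (c_frame/96, 1/8, 2)`.

HONEST LABEL: glue between rungs of the OPEN stub S1 of the OPEN lines g21-A/B; with it the S1 programme reads
`S1 ⇐ ApertureBootstrap (XL) ∧ LukacsOneDim ∧ QuantitativeCrossAnalyticity` through kernel-checked links only; nothing of S1, ⟨23125⟩, ⟨23035⟩,
R2d is proved here and the Yang–Mills mass gap is NOT proved; no summit is proved by a line.  Lead seat `ym-line-sfw-p2` g75 (cell ym-idea-1, free
hands; own crux ⟨22884⟩ is line-dead, not claimed false).
-/

set_option autoImplicit false

noncomputable section

open MeasureTheory Filter Topology Set Metric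
open scoped BigOperators

namespace Summit.QuantumFields.YangMills.Theorems.F4SubCurvatureDoorLinearApertureOfRegistered

open Summit.QuantumFields.YangMills.Theorems.F4SubCurvatureDoorLaplaceFourierRegistered (E4 E3 InClass timeSpace IsLF)
open Summit.QuantumFields.YangMills.Theorems.F4SubCurvatureDoorLaplacianMultiplierRegistered (timeSpace_apply_zero timeSpace_apply_succ)
open Summit.QuantumFields.YangMills.Theorems.F4SubCurvatureDoorDirectionalExtensionRegistered
  (IsD4Isometry DirectionalExtension inner_timeSpace_one_zero timeSpace_one_zero)
open Summit.QuantumFields.YangMills.Theorems.F4SubCurvatureDoorFibreDichotomyAxis (hadIso signIso hadIso_zero signIso_apply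
  isD4Isometry_hadIso isD4Isometry_signIso)

/-! ## The three Props (character-identical with `Lines/forward_cone_rungs.lean` v4) -/

/-- R-S1b «LINEAR APERTURE WITH AXIS BOUND» (L; dilation invariance of the class makes the aperture linear in `t`; the cross-theorem extension is
bounded by the directional bounds, i.e. by the axis function at a fixed fraction of `t`). -/
def LinearAperture : Prop :=
  ∃ κ c C₀ : ℝ, 0 < κ ∧ 0 < c ∧ 0 < C₀ ∧
    ∀ (K : E4 → ℝ) (μ : Measure (ℝ × E3)), InClass K → IsLF K μ →
      ∀ t : ℝ, 0 < t →
        Integrable (fun p : ℝ × E3 => Real.exp (-(t * p.1) + κ * t * ‖p.2‖)) μ ∧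
        ∫ p : ℝ × E3, Real.exp (-(t * p.1) + κ * t * ‖p.2‖) ∂μ ≤ C₀ * K (timeSpace (c * t) 0)


/-- R-S1×⁺ «QUANTITATIVE CROSS THEOREM» (L; Siciak's explicit extension domain `X̂ = {Σ_j h_j(z_j) < 1}` is scale-covariant and the extension obeys
the two-constants bound `‖f̂‖_X̂ ≤ ‖f‖_X`): same hypotheses as `CrossAnalyticity` with `ε = r`, conclusion a holomorphic extension to the complex
ball of radius `c·r` about `x₀` with the SAME bound `M`, `c > 0` depending only on the frame `v`.  This (not the qualitative `CrossAnalyticity`) is what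
`LinearAperture` needs: at `x₀ = t e₀` the data of `DirectionalExtension` have `r ≍ t` and `M = sup_{[t/8, 2t]}` of the axis function `= L_μ(t/8)`
(monotone), so `y⃗ ↦ K(t, iy⃗)` is bounded by `L_μ(t/8)` for `|y⃗| < c' t`, and Vivanti–Pringsheim (non-negative even Taylor coefficients) identifies it
with `∫ e^{−tE} cosh(q⃗·y⃗) dμ`. -/
def QuantitativeCrossAnalyticity : Prop :=
  ∀ (v : Fin 4 → E4), LinearIndependent ℝ v → ∃ c : ℝ, 0 < c ∧
    ∀ (f : E4 → ℝ) (x₀ : E4) (r M : ℝ), 0 < r → ContinuousOn f (Metric.ball x₀ r) →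
      (∀ x : E4, dist x x₀ < r → ∀ j : Fin 4, ∃ F : ℂ → ℂ, DifferentiableOn ℂ F (Metric.ball 0 r) ∧
          (∀ a : ℝ, |a| < r → F (a : ℂ) = ((f (x + a • v j) : ℝ) : ℂ)) ∧ ∀ w ∈ Metric.ball (0 : ℂ) r, ‖F w‖ ≤ M) →
      ∃ G : (Fin 4 → ℂ) → ℂ, DifferentiableOn ℂ G (Metric.ball (fun i => ((x₀ i : ℝ) : ℂ)) (c * r)) ∧
        (∀ x : E4, dist x x₀ < c * r → G (fun i => ((x i : ℝ) : ℂ)) = ((f x : ℝ) : ℂ)) ∧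
        ∀ z ∈ Metric.ball (fun i => ((x₀ i : ℝ) : ℂ)) (c * r), ‖G z‖ ≤ M

/-- «PRINGSHEIM IDENTIFICATION» (M; Vivanti–Pringsheim for cosine transforms of positive measures, three variables): if the spatial slice
`x⃗ ↦ K(t, x⃗) = ∫ e^{−tE} cos(q⃗·x⃗) dμ` is the restriction of a function holomorphic and bounded by `M` on the complex sup-ball of radius `ρ` about `0`,
then the exponential moments up to aperture `ρ` exist and are bounded by `2M` along every coordinate direction. -/
def PringsheimIdentification : Prop :=
  ∀ (μ : Measure (ℝ × E3)) (t ρ M : ℝ), 0 < t → 0 < ρ →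
    Integrable (fun p : ℝ × E3 => Real.exp (-(t * p.1))) μ →
    (∃ G : (Fin 3 → ℂ) → ℂ, DifferentiableOn ℂ G (Metric.ball 0 ρ) ∧ (∀ z ∈ Metric.ball (0 : Fin 3 → ℂ) ρ, ‖G z‖ ≤ M) ∧
        ∀ y : Fin 3 → ℝ, (∀ j, |y j| < ρ) →
          G (fun j => ((y j : ℝ) : ℂ)) = ((∫ p : ℝ × E3, Real.exp (-(t * p.1)) * Real.cos (∑ j, p.2 j * y j) ∂μ : ℝ) : ℂ)) →
    ∀ (j : Fin 3) (δ : ℝ), 0 < δ → δ < ρ →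
      Integrable (fun p : ℝ × E3 => Real.exp (-(t * p.1) + δ * |p.2 j|)) μ ∧
      ∫ p : ℝ × E3, Real.exp (-(t * p.1) + δ * |p.2 j|) ∂μ ≤ 2 * M


/-! ## The frame: `e₀` and three half-integer short roots, as images of `e₀` under `D₄`-isometries -/

/-- Sign pattern flipping the coordinates `2, 3` (`true` = keep). -/
def sgn₂ : Fin 4 → Bool := ![true, true, false, false]

/-- Sign pattern flipping the coordinates `1, 3` (`true` = keep). -/
def sgn₃ : Fin 4 → Bool := ![true, false, true, false]

/-- The four `D₄`-isometries of the frame: `refl`, Hadamard/2, and Hadamard/2 followed by two sign patterns. -/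
def frameIso : Fin 4 → (E4 ≃ₗᵢ[ℝ] E4) :=
  ![LinearIsometryEquiv.refl ℝ E4, hadIso, hadIso.trans (signIso sgn₂), hadIso.trans (signIso sgn₃)]

/-- The frame vectors `vⱼ = Rⱼ e₀`. -/
def frame (j : Fin 4) : E4 := frameIso j (timeSpace 1 0)

/-- Coordinates of the frame vectors: `v₀ = e₀`, `v₁ = ½(1,1,1,1)`, `v₂ = ½(1,1,−1,−1)`, `v₃ = ½(1,−1,1,−1)`. -/
def frameCoord : Fin 4 → Fin 4 → ℝ :=
  ![![1, 0, 0, 0], ![1 / 2, 1 / 2, 1 / 2, 1 / 2], ![1 / 2, 1 / 2, -(1 / 2), -(1 / 2)], ![1 / 2, -(1 / 2), 1 / 2, -(1 / 2)]]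

/-- Every frame isometry preserves `D₄`. -/
theorem isD4Isometry_frameIso (j : Fin 4) : IsD4Isometry (frameIso j) := by
  have h0 : IsD4Isometry (LinearIsometryEquiv.refl ℝ E4) := fun z hz => ⟨z, hz, rfl⟩
  have h1 : IsD4Isometry hadIso := isD4Isometry_hadIso
  have h2 : IsD4Isometry (hadIso.trans (signIso sgn₂)) := isD4Isometry_hadIso.trans (isD4Isometry_signIso sgn₂)
  have h3 : IsD4Isometry (hadIso.trans (signIso sgn₃)) := isD4Isometry_hadIso.trans (isD4Isometry_signIso sgn₃)
  fin_cases j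
  exacts [h0, h1, h2, h3]

/-- Coordinates of `e₀`. -/
theorem timeSpace_one_zero_apply (i : Fin 4) : timeSpace 1 (0 : E3) i = if i = 0 then 1 else 0 := by
  cases i using Fin.cases with
  | zero => simp [timeSpace_apply_zero]
  | succ j => simp [timeSpace_apply_succ, Fin.succ_ne_zero]

/-- The coordinate table of the frame. -/
theorem frame_apply (j i : Fin 4) : frame j i = frameCoord j i := by
  fin_cases j <;> fin_cases i <;>
    simp [frame, frameIso, frameCoord, hadIso, Summit.QuantumFields.YangMills.Theorems.F4SubCurvatureDoorFibreDichotomyAxis.hadLin,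
      signIso_apply, sgn₂, sgn₃, timeSpace_one_zero_apply]

/-- Inner products with the frame vectors, in coordinates. -/
theorem inner_frame (x : E4) (j : Fin 4) : inner ℝ x (frame j) = ∑ i, x i * frameCoord j i := by
  simp [PiLp.inner_apply, mul_comm, frame_apply]

/-- The frame is linearly independent. -/
theorem linearIndependent_frame : LinearIndependent ℝ frame := by
  rw [Fintype.linearIndependent_iff]
  intro g hg
  have hc : ∀ i : Fin 4, ∑ j, g j * frameCoord j i = 0 := by
    intro i
    have := congrArg (fun w : E4 => w i) hg
    simpa [Finset.sum_apply, frame_apply] using this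
  have e0 := hc 0
  have e1 := hc 1
  have e2 := hc 2
  have e3 := hc 3
  simp [Fin.sum_univ_four, frameCoord] at e0 e1 e2 e3
  intro i
  fin_cases i
  · show g 0 = 0; linarith
  · show g 1 = 0; linarith
  · show g 2 = 0; linarith
  · show g 3 = 0; linarith


/-! ## Geometry at the axis point `x₀ = t e₀` with radius `r = t/8` -/

/-- `|xᵢ| ≤ ‖x‖` in Euclidean space. -/
theorem abs_apply_le_norm (x : E4) (i : Fin 4) : |x i| ≤ ‖x‖ := by
  simpa using PiLp.norm_apply_le x i

/-- `‖x‖ ≤ Σᵢ |xᵢ|` in Euclidean space. -/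
theorem norm_le_sum_abs {k : ℕ} (x : EuclideanSpace ℝ (Fin k)) : ‖x‖ ≤ ∑ i, |x i| := by
  have hsq : ‖x‖ ^ 2 ≤ (∑ i, |x i|) ^ 2 := by
    rw [EuclideanSpace.norm_eq, Real.sq_sqrt (Finset.sum_nonneg fun i _ => sq_nonneg _), sq, Finset.sum_mul_sum]
    refine Finset.sum_le_sum fun i _ => ?_
    rw [Real.norm_eq_abs, sq]
    exact Finset.single_le_sum (f := fun j => |x i| * |x j|) (fun j _ => mul_nonneg (abs_nonneg _) (abs_nonneg _))
      (Finset.mem_univ i)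
  have h0 : 0 ≤ ∑ i, |x i| := Finset.sum_nonneg fun i _ => abs_nonneg _
  nlinarith [norm_nonneg x, hsq, h0]

/-- On the Euclidean ball of radius `t/8` about `t e₀`, every frame functional is at least `t/4`. -/
theorem inner_frame_ge {t : ℝ} (ht : 0 < t) {x : E4} (hx : dist x (timeSpace t 0) < t / 8) (j : Fin 4) :
    t / 4 ≤ inner ℝ x (frame j) := by
  have hd : ∀ i : Fin 4, |(x - timeSpace t 0) i| < t / 8 := fun i =>
    lt_of_le_of_lt (abs_apply_le_norm _ i) (by rwa [dist_eq_norm] at hx)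
  have h0 := hd 0
  have h1 := hd 1
  have h2 := hd 2
  have h3 := hd 3
  simp only [PiLp.sub_apply, timeSpace_apply_zero] at h0
  rw [show (1 : Fin 4) = (0 : Fin 3).succ from rfl, PiLp.sub_apply, timeSpace_apply_succ] at h1
  rw [show (2 : Fin 4) = (1 : Fin 3).succ from rfl, PiLp.sub_apply, timeSpace_apply_succ] at h2
  rw [show (3 : Fin 4) = (2 : Fin 3).succ from rfl, PiLp.sub_apply, timeSpace_apply_succ] at h3
  simp only [PiLp.zero_apply, sub_zero] at h1 h2 h3
  rw [abs_lt] at h0 h1 h2 h3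
  rw [inner_frame, Fin.sum_univ_four]
  have e1 : x 1 = x (0 : Fin 3).succ := rfl
  have e2 : x 2 = x (1 : Fin 3).succ := rfl
  have e3 : x 3 = x (2 : Fin 3).succ := rfl
  fin_cases j <;> simp [frameCoord] <;> linarith [h0.1, h0.2, h1.1, h1.2, h2.1, h2.2, h3.1, h3.2]

/-- The ball of radius `t/8` about `t e₀` avoids the origin. -/
theorem ne_zero_of_mem_ball {t : ℝ} (ht : 0 < t) {x : E4} (hx : dist x (timeSpace t 0) < t / 8) : x ≠ 0 := by
  intro h0
  have h := lt_of_le_of_lt (abs_apply_le_norm (x - timeSpace t 0) 0) (by rwa [dist_eq_norm] at hx)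
  rw [PiLp.sub_apply, timeSpace_apply_zero, h0, PiLp.zero_apply, zero_sub, abs_neg, abs_of_pos ht] at h
  linarith

/-- The real spatial cube of side `ρ` at time `t` lies in the Euclidean ball of radius `3ρ` (indeed `√3ρ`) about `t e₀`. -/
theorem dist_timeSpace_lt {t ρ : ℝ} (y : Fin 3 → ℝ) (hy : ∀ j, |y j| < ρ) :
    dist (timeSpace t ((WithLp.equiv 2 (Fin 3 → ℝ)).symm y)) (timeSpace t 0) < 4 * ρ := by
  have hρ : 0 < ρ := lt_of_le_of_lt (abs_nonneg _) (hy 0)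
  rw [dist_eq_norm]
  refine lt_of_le_of_lt (norm_le_sum_abs _) ?_
  rw [Fin.sum_univ_succ, PiLp.sub_apply, timeSpace_apply_zero, timeSpace_apply_zero, sub_self, abs_zero, zero_add]
  simp only [PiLp.sub_apply, timeSpace_apply_succ, PiLp.zero_apply, sub_zero]
  calc ∑ j : Fin 3, |((WithLp.equiv 2 (Fin 3 → ℝ)).symm y) j| = ∑ j : Fin 3, |y j| := by simp
    _ < ∑ _j : Fin 3, ρ := Finset.sum_lt_sum_of_nonempty Finset.univ_nonempty fun j _ => hy j
    _ = 3 * ρ := by simp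
    _ < 4 * ρ := by linarith

/-! ## The axis function `s ↦ K(s e₀) = ∫ e^{−sE} dμ` -/

/-- On the axis the Laplace–Fourier representation has no cosine. -/
theorem axis_eq {K : E4 → ℝ} {μ : Measure (ℝ × E3)} (hLF : IsLF K μ) {s : ℝ} (hs : 0 < s) :
    K (timeSpace s 0) = ∫ p : ℝ × E3, Real.exp (-(s * p.1)) ∂μ := by
  rw [hLF.2.2 s 0 hs]
  simp

/-- Energies are a.e. non-negative under a Laplace–Fourier measure. -/
theorem ae_energy_nonneg {K : E4 → ℝ} {μ : Measure (ℝ × E3)} (hLF : IsLF K μ) : ∀ᵐ p ∂μ, 0 ≤ p.1 := by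
  have h := hLF.1
  rw [measure_eq_zero_iff_ae_notMem] at h
  filter_upwards [h] with p hp
  by_contra hneg
  exact hp ⟨not_le.1 hneg, Set.mem_univ _⟩

/-- The axis function is antitone on `(0, ∞)`. -/
theorem axis_antitone {K : E4 → ℝ} {μ : Measure (ℝ × E3)} (hLF : IsLF K μ) {s s' : ℝ} (hs : 0 < s) (hss' : s ≤ s') :
    K (timeSpace s' 0) ≤ K (timeSpace s 0) := by
  rw [axis_eq hLF hs, axis_eq hLF (lt_of_lt_of_le hs hss')]
  refine integral_mono_ae (hLF.2.1 s' (lt_of_lt_of_le hs hss')) (hLF.2.1 s hs) ?_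
  filter_upwards [ae_energy_nonneg hLF] with p hp
  exact Real.exp_le_exp.2 (by nlinarith)

/-! ## AM–GM over the three spatial axes -/

/-- `e^{a+b+c} ≤ ⅓(e^{3a} + e^{3b} + e^{3c})` (arithmetic–geometric mean). -/
theorem exp_add_three_le (a b c : ℝ) :
    Real.exp (a + b + c) ≤ (Real.exp (3 * a) + Real.exp (3 * b) + Real.exp (3 * c)) / 3 := by
  have h := Real.geom_mean_le_arith_mean3_weighted (w₁ := 1 / 3) (w₂ := 1 / 3) (w₃ := 1 / 3) (p₁ := Real.exp (3 * a))
    (p₂ := Real.exp (3 * b)) (p₃ := Real.exp (3 * c)) (by norm_num) (by norm_num) (by norm_num) (Real.exp_pos _).le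
    (Real.exp_pos _).le (Real.exp_pos _).le (by norm_num)
  have e : ∀ x : ℝ, Real.exp (3 * x) ^ (1 / 3 : ℝ) = Real.exp x := fun x => by
    rw [← Real.exp_mul]; congr 1; ring
  rw [e, e, e, ← Real.exp_add, ← Real.exp_add] at h
  linarith

/-- The complex coordinates of `timeSpace t y`: `(t, y₁, y₂, y₃)`. -/
theorem ofReal_timeSpace (t : ℝ) (y : Fin 3 → ℝ) :
    (fun i => (((timeSpace t ((WithLp.equiv 2 (Fin 3 → ℝ)).symm y)) i : ℝ) : ℂ)) =
      Fin.cons (t : ℂ) (fun j => ((y j : ℝ) : ℂ)) := by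
  funext i
  cases i using Fin.cases with
  | zero => simp [timeSpace_apply_zero]
  | succ j => simp [timeSpace_apply_succ]

/-- `z⃗ ↦ (t, z⃗)` is complex-differentiable. -/
theorem differentiable_finCons (t : ℂ) : Differentiable ℂ (fun z : Fin 3 → ℂ => (Fin.cons t z : Fin 4 → ℂ)) := by
  refine differentiable_pi.mpr fun i => ?_
  cases i using Fin.cases with
  | zero => simp only [Fin.cons_zero]; exact differentiable_const _
  | succ j => simp only [Fin.cons_succ]; exact differentiable_apply j

/-! ## The glue -/

/-- **GLUE (owner's «M glue», ym-idea-3 g21 12:10:34Z): `LinearAperture` from `DirectionalExtension`, `QuantitativeCrossAnalyticity` and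
`PringsheimIdentification`**, with `(κ, c, C₀) = (c_frame/192, 1/8, 2)`. -/
theorem linearAperture_of (hDE : DirectionalExtension) (hQC : QuantitativeCrossAnalyticity)
    (hPI : PringsheimIdentification) : LinearAperture := by
  obtain ⟨c, hc, hG⟩ := hQC frame linearIndependent_frame
  refine ⟨c / 192, 1 / 8, 2, by positivity, by norm_num, by norm_num, fun K μ hK hLF t ht => ?_⟩
  -- data at `x₀ = t e₀`, radius `r = t/8`, bound `M = K(t/8 · e₀)`
  set x₀ : E4 := timeSpace t 0 with hx₀
  set r : ℝ := t / 8 with hr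
  have hr0 : 0 < r := by positivity
  set M : ℝ := K (timeSpace (1 / 8 * t) 0) with hM
  have hcont : ContinuousOn K (Metric.ball x₀ r) :=
    hK.1.mono fun x hx => ne_zero_of_mem_ball ht (Metric.mem_ball.1 hx)
  -- the directional extensions along the frame, with the uniform bound `M`
  have hdir : ∀ x : E4, dist x x₀ < r → ∀ j : Fin 4, ∃ F : ℂ → ℂ, DifferentiableOn ℂ F (Metric.ball 0 r) ∧
      (∀ a : ℝ, |a| < r → F (a : ℂ) = ((K (x + a • frame j) : ℝ) : ℂ)) ∧ ∀ w ∈ Metric.ball (0 : ℂ) r, ‖F w‖ ≤ M := by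
    intro x hx j
    have hge : t / 4 ≤ inner ℝ x (frame j) := inner_frame_ge ht hx j
    have hfr : (frameIso j) (timeSpace 1 0) = frame j := rfl
    have hpos : 0 < inner ℝ x ((frameIso j) (timeSpace 1 0)) := by rw [hfr]; linarith
    obtain ⟨F, hFd, hFr, hFb⟩ := hDE K μ hK hLF (frameIso j) (isD4Isometry_frameIso j) x hpos
    rw [hfr] at hFd hFr hFb
    refine ⟨F, hFd.mono ?_, fun a ha => hFr a ?_, fun w hw => ?_⟩
    · intro w hw
      have hw' : ‖w‖ < r := mem_ball_zero_iff.1 hw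
      have hre : |w.re| ≤ ‖w‖ := Complex.abs_re_le_norm w
      rw [abs_le] at hre
      show -(inner ℝ x (frame j)) < w.re
      linarith
    · rw [abs_lt] at ha
      linarith
    · have hw' : ‖w‖ < r := mem_ball_zero_iff.1 hw
      have hre : |w.re| ≤ ‖w‖ := Complex.abs_re_le_norm w
      rw [abs_le] at hre
      refine (hFb w (by linarith)).trans (axis_antitone hLF (by positivity) ?_)
      linarith
  -- the cross theorem: ONE holomorphic `G` on the complex sup-ball of radius `c·r` about `x₀`
  obtain ⟨G, hGd, hGr, hGb⟩ := hG K x₀ r M hr0 hcont hdir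
  -- the spatial slice at time `t`, radius `ρ = c·r/4`
  set ρ : ℝ := c * r / 4 with hρ
  have hρ0 : 0 < ρ := by positivity
  have hx₀C : (fun i => ((x₀ i : ℝ) : ℂ)) = Fin.cons (t : ℂ) (fun _ : Fin 3 => (0 : ℂ)) := by
    have := ofReal_timeSpace t (fun _ : Fin 3 => (0 : ℝ))
    have h0 : (WithLp.equiv 2 (Fin 3 → ℝ)).symm (fun _ : Fin 3 => (0 : ℝ)) = (0 : E3) := rfl
    rw [h0] at this
    simpa using this
  have hmaps : MapsTo (fun z : Fin 3 → ℂ => (Fin.cons (t : ℂ) z : Fin 4 → ℂ)) (Metric.ball (0 : Fin 3 → ℂ) ρ)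
      (Metric.ball (fun i => ((x₀ i : ℝ) : ℂ)) (c * r)) := by
    intro z hz
    rw [Metric.mem_ball, dist_pi_lt_iff hρ0] at hz
    rw [hx₀C, Metric.mem_ball, dist_pi_lt_iff (by positivity)]
    intro i
    cases i using Fin.cases with
    | zero => simp only [Fin.cons_zero, dist_self]; positivity
    | succ j =>
      simp only [Fin.cons_succ]
      exact (hz j).trans_le (by rw [hρ]; linarith [mul_pos hc hr0])
  set G₃ : (Fin 3 → ℂ) → ℂ := fun z => G (Fin.cons (t : ℂ) z) with hG₃
  have hG₃d : DifferentiableOn ℂ G₃ (Metric.ball 0 ρ) := hGd.comp (differentiable_finCons (t : ℂ)).differentiableOn hmaps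
  have hG₃b : ∀ z ∈ Metric.ball (0 : Fin 3 → ℂ) ρ, ‖G₃ z‖ ≤ M := fun z hz => hGb _ (hmaps hz)
  have hG₃r : ∀ y : Fin 3 → ℝ, (∀ j, |y j| < ρ) →
      G₃ (fun j => ((y j : ℝ) : ℂ)) = ((∫ p : ℝ × E3, Real.exp (-(t * p.1)) * Real.cos (∑ j, p.2 j * y j) ∂μ : ℝ) : ℂ) := by
    intro y hy
    have hdist : dist (timeSpace t ((WithLp.equiv 2 (Fin 3 → ℝ)).symm y)) x₀ < c * r := by
      have h := dist_timeSpace_lt (t := t) y hy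
      have h4 : 4 * ρ = c * r := by rw [hρ]; ring
      rw [h4] at h
      exact h
    have h1 := hGr _ hdist
    rw [ofReal_timeSpace] at h1
    show G (Fin.cons (t : ℂ) (fun j => ((y j : ℝ) : ℂ))) = _
    rw [h1, hLF.2.2 t _ ht]
    congr 1
    refine integral_congr_ae (ae_of_all _ fun p => ?_)
    simp [PiLp.inner_apply, mul_comm]
  -- Pringsheim on the three axes, aperture `δ = c t / 64 < ρ = c t / 32`
  set δ : ℝ := 3 * (c / 192 * t) with hδ
  have hδ0 : 0 < δ := by positivity
  have hδρ : δ < ρ := by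
    have h : ρ - δ = c * t / 64 := by rw [hρ, hδ, hr]; ring
    have := mul_pos hc ht
    linarith
  have hax : ∀ j : Fin 3, Integrable (fun p : ℝ × E3 => Real.exp (-(t * p.1) + δ * |p.2 j|)) μ ∧
      ∫ p : ℝ × E3, Real.exp (-(t * p.1) + δ * |p.2 j|) ∂μ ≤ 2 * M :=
    fun j => hPI μ t ρ M ht hρ0 (hLF.2.1 t ht) ⟨G₃, hG₃d, hG₃b, hG₃r⟩ j δ hδ0 hδρ
  -- AM–GM: `e^{κt‖q⃗‖} ≤ ⅓ Σⱼ e^{3κt|qⱼ|}`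
  set g : ℝ × E3 → ℝ := fun p => (Real.exp (-(t * p.1) + δ * |p.2 0|) + Real.exp (-(t * p.1) + δ * |p.2 1|) +
    Real.exp (-(t * p.1) + δ * |p.2 2|)) / 3 with hg
  have hpt : ∀ p : ℝ × E3, Real.exp (-(t * p.1) + c / 192 * t * ‖p.2‖) ≤ g p := by
    intro p
    have hκt : 0 ≤ c / 192 * t := by positivity
    have hn : ‖p.2‖ ≤ |p.2 0| + |p.2 1| + |p.2 2| := by
      have := norm_le_sum_abs p.2
      simpa [Fin.sum_univ_three] using this
    have h1 : Real.exp (-(t * p.1) + c / 192 * t * ‖p.2‖) ≤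
        Real.exp (-(t * p.1)) * Real.exp (c / 192 * t * |p.2 0| + c / 192 * t * |p.2 1| + c / 192 * t * |p.2 2|) := by
      rw [← Real.exp_add]
      exact Real.exp_le_exp.2 (by nlinarith)
    have h2 := exp_add_three_le (c / 192 * t * |p.2 0|) (c / 192 * t * |p.2 1|) (c / 192 * t * |p.2 2|)
    have h3 : ∀ j : Fin 3, Real.exp (-(t * p.1)) * Real.exp (3 * (c / 192 * t * |p.2 j|)) =
        Real.exp (-(t * p.1) + δ * |p.2 j|) := fun j => by
      rw [← Real.exp_add, hδ]; ring_nf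
    calc Real.exp (-(t * p.1) + c / 192 * t * ‖p.2‖)
        ≤ Real.exp (-(t * p.1)) * Real.exp (c / 192 * t * |p.2 0| + c / 192 * t * |p.2 1| + c / 192 * t * |p.2 2|) := h1
      _ ≤ Real.exp (-(t * p.1)) *
          ((Real.exp (3 * (c / 192 * t * |p.2 0|)) + Real.exp (3 * (c / 192 * t * |p.2 1|)) +
            Real.exp (3 * (c / 192 * t * |p.2 2|))) / 3) := mul_le_mul_of_nonneg_left h2 (Real.exp_pos _).le
      _ = g p := by rw [hg]; dsimp only; rw [← h3 0, ← h3 1, ← h3 2]; ring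
  have hgi : Integrable g μ := (((hax 0).1.add (hax 1).1).add (hax 2).1).div_const 3
  have hmeas : AEStronglyMeasurable (fun p : ℝ × E3 => Real.exp (-(t * p.1) + c / 192 * t * ‖p.2‖)) μ :=
    (Continuous.aestronglyMeasurable (by fun_prop))
  have hint : Integrable (fun p : ℝ × E3 => Real.exp (-(t * p.1) + c / 192 * t * ‖p.2‖)) μ :=
    Integrable.mono' hgi hmeas (ae_of_all _ fun p => by
      rw [Real.norm_eq_abs, abs_of_pos (Real.exp_pos _)]; exact hpt p)
  refine ⟨hint, ?_⟩
  have hsplit : ∫ p, g p ∂μ = ((∫ p : ℝ × E3, Real.exp (-(t * p.1) + δ * |p.2 0|) ∂μ) +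
      (∫ p : ℝ × E3, Real.exp (-(t * p.1) + δ * |p.2 1|) ∂μ) + ∫ p : ℝ × E3, Real.exp (-(t * p.1) + δ * |p.2 2|) ∂μ) / 3 := by
    rw [hg]; dsimp only
    rw [integral_div]
    congr 1
    rw [integral_add _ (hax 2).1, integral_add (hax 0).1 (hax 1).1]
    exact (hax 0).1.add (hax 1).1
  calc ∫ p, Real.exp (-(t * p.1) + c / 192 * t * ‖p.2‖) ∂μ ≤ ∫ p, g p ∂μ := integral_mono hint hgi hpt
    _ ≤ (2 * M + 2 * M + 2 * M) / 3 := by rw [hsplit]; gcongr; exacts [(hax 0).2, (hax 1).2, (hax 2).2]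
    _ = 2 * K (timeSpace (1 / 8 * t) 0) := by rw [hM]; ring

end Summit.QuantumFields.YangMills.Theorems.F4SubCurvatureDoorLinearApertureOfRegistered

end
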